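import Summits.CriticalPhenomena.PercolationContinuityZ3.Theorems.PercNearOneGluingNoHeavyLowerTailAntitheticConesLocal
import HarnessLib

/-!
# `NoHeavyLowerTail` (stmt-CriticalPhenomena-4575) — antithetic cluster pairs: THEOREM I for cones with HANGING subgraphs
# (prim-hp-2 gen 36, MEMO-gen36 §2/§4)

Support file (`--supports stmt-CriticalPhenomena-4575`, hull-port prover `prim-hp-2`, gen 36).  No definitions, no named facts, no sorries;
standard axioms.

THEOREM I (`Antithetic.cone_bic_nonneg`) and its R-local form (`Antithetic.cone_local_bic_nonneg`) need a spoke `sx ∈ E` at every vertex `x` of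
the relevant components of `G − s`, for one reason only: two zones sharing an edge must carry spokes of the same colour, and the shared vertex is
where the two spoke colours are compared.  It is enough that every spoke-less vertex `x` HANGS from a spoked vertex `y(x)` — every walk of `G − s`
from a spoked vertex to `x` passes through `y(x)` — because a zone containing `x` then contains `y(x)` (zones are clusters of `G − s` through a
spoked `R`-vertex).  So BIC_G(R) ≥ 0 for `R ⊆ N(s)` on every "cone with hanging subgraphs": `s` joined to a set `S₀`, arbitrary edges inside `S₀`,
and arbitrary further subgraphs each attached to the rest through a single vertex of `S₀` (pendant trees, pendant blocks, …) — the first BIC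
theorem for graphs in which `G − s` has cycles far from `s` AND vertices not adjacent to `s` (wheels with hanging trees, fans with pendant cliques).
* `Antithetic.Cone.mem_zone_of_mem_support` — a vertex on every `(G − s)`-walk from `u` to a zone vertex of `u` lies in the zone;
* `Antithetic.Cone.spoke_iff_of_mem_zblock_hanging` — consistency of spoke colours on overlapping zone blocks under the hanging hypothesis;
* `Antithetic.cone_hanging_bic_nonneg` — the theorem.
[cite: VandenbergHaggstromKahn2005, §1 p. 6 ("Harris' inequality"), §1 p. 3 (open cluster `C_s`)]
-/

noncomputable section

namespace Summit.CriticalPhenomena.PercolationContinuityZ3.Theorems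

open Literature.Probability.Percolation
open scoped Classical symmDiff

namespace Antithetic

namespace Cone

variable {V : Type*} {E : Set (Sym2 V)} {s : V} {R : Set V} {T : Set (Sym2 V)}

/-- If `y` lies on every `(G − s)`-walk from `u` to a vertex `z` of the zone of `u`, then `y` lies in the zone of `u` (the zone is a cluster of
`H`-edges of one colour through `u`; cut the defining walk at `y`). [this work] -/
theorem mem_zone_of_mem_support {u z y : V} (hz : z ∈ zone E s T u)
    (hy : ∀ p : (openGraph (hEdges E s)).Walk u z, y ∈ p.support) : y ∈ zone E s T u := by
  obtain ⟨q⟩ := (show (openGraph (oppConf E s T u)).Reachable u z from hz)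
  have hq : ∀ e, e ∈ q.edges → e ∈ (openGraph (hEdges E s)).edgeSet := fun e he => by
    have := q.edges_subset_edgeSet he
    rw [openGraph, SimpleGraph.edgeSet_fromEdgeSet] at this ⊢
    exact ⟨this.1.2, this.2⟩
  have hyq : y ∈ q.support := by
    have := hy (q.transfer _ hq)
    rwa [SimpleGraph.Walk.support_transfer] at this
  obtain ⟨r, -, -⟩ := SimpleGraph.Walk.mem_support_iff_exists_append.1 hyq
  exact ⟨r⟩

/-- A common vertex of two zones forces equal spoke colours, provided the common vertex is spoked or hangs from a spoked vertex. [this work] -/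
theorem spoke_iff_of_mem_zone_of_mem_zone (hRN : ∀ u ∈ R, s(s, u) ∈ E) (hRs : s ∉ R)
    (hT : ∀ r ∈ R, ¬ ((openGraph (T ∩ E)).Reachable s r ∧ (openGraph (Tᶜ ∩ E)).Reachable s r))
    (hhang : ∀ x, x ≠ s → s(s, x) ∉ E → (∃ u ∈ R, (openGraph (hEdges E s)).Reachable u x) →
      ∃ y, s(s, y) ∈ E ∧ ∀ w, s(s, w) ∈ E → ∀ p : (openGraph (hEdges E s)).Walk w x, y ∈ p.support)
    {u v c : V} (hu : u ∈ R) (hv : v ∈ R) (hcu : c ∈ zone E s T u) (hcv : c ∈ zone E s T v) :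
    (s(s, u) ∈ T ↔ s(s, v) ∈ T) := by
  have hus : u ≠ s := fun h => hRs (h ▸ hu)
  have hvs : v ≠ s := fun h => hRs (h ▸ hv)
  -- a spoked vertex `y` common to both zones
  obtain ⟨y, hyE, hyu, hyv⟩ : ∃ y, s(s, y) ∈ E ∧ y ∈ zone E s T u ∧ y ∈ zone E s T v := by
    by_cases hc : s(s, c) ∈ E
    · exact ⟨c, hc, hcu, hcv⟩
    · obtain ⟨y, hyE, hy⟩ := hhang c (ne_apex_of_mem_zone hus hcu) hc ⟨u, hu, hReachable_of_mem_zone hcu⟩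
      exact ⟨y, hyE, mem_zone_of_mem_support hcu (hy u (hRN u hu)), mem_zone_of_mem_support hcv (hy v (hRN v hv))⟩
  exact (spoke_iff_of_mem_zone hus (hRN u hu) (hT u hu) hyu hyE).symm.trans
    (spoke_iff_of_mem_zone hvs (hRN v hv) (hT v hv) hyv hyE)

/-- **Consistency of spoke colours on overlapping blocks, hanging form.** [this work] -/
theorem spoke_iff_of_mem_zblock_hanging (hRN : ∀ u ∈ R, s(s, u) ∈ E) (hRs : s ∉ R)
    (hT : ∀ r ∈ R, ¬ ((openGraph (T ∩ E)).Reachable s r ∧ (openGraph (Tᶜ ∩ E)).Reachable s r))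
    (hhang : ∀ x, x ≠ s → s(s, x) ∉ E → (∃ u ∈ R, (openGraph (hEdges E s)).Reachable u x) →
      ∃ y, s(s, y) ∈ E ∧ ∀ w, s(s, w) ∈ E → ∀ p : (openGraph (hEdges E s)).Walk w x, y ∈ p.support)
    {u v : V} (hu : u ∈ R) (hv : v ∈ R) {e : Sym2 V} (heu : e ∈ zblock E s T u) (hev : e ∈ zblock E s T v) :
    (s(s, u) ∈ T ↔ s(s, v) ∈ T) := by
  have heE : e ∈ E := heu.1
  have COMMON : ∀ c, c ∈ zone E s T u → c ∈ zone E s T v → (s(s, u) ∈ T ↔ s(s, v) ∈ T) := fun c hcu hcv =>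
    spoke_iff_of_mem_zone_of_mem_zone hRN hRs hT hhang hu hv hcu hcv
  induction e using Sym2.ind with
  | h a b =>
    have A4 : ∀ w ∈ R, ¬ (a ∈ zone E s T w ∧ b ∈ zone E s T w) → (a ∈ zone E s T w ∨ b ∈ zone E s T w) →
        (s(a, b) ∈ T ↔ s(s, w) ∈ T) := by
      intro w hw hnot hor
      have hws : w ≠ s := fun h => hRs (h ▸ hw)
      rcases hor with ha | hb
      · have hb : b ∉ zone E s T w := fun hb => hnot ⟨ha, hb⟩
        rw [Sym2.eq_swap]
        exact boundary_iff hws (hRN w hw) (hT w hw) hb ha (by rw [Sym2.eq_swap]; exact heE)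
      · have ha : a ∉ zone E s T w := fun ha => hnot ⟨ha, hb⟩
        exact boundary_iff hws (hRN w hw) (hT w hw) ha hb heE
    have horu : a ∈ zone E s T u ∨ b ∈ zone E s T u := by
      obtain ⟨_, x, hx, hxe⟩ := heu
      rcases Sym2.mem_iff.1 hxe with rfl | rfl
      · exact Or.inl hx
      · exact Or.inr hx
    have horv : a ∈ zone E s T v ∨ b ∈ zone E s T v := by
      obtain ⟨_, x, hx, hxe⟩ := hev
      rcases Sym2.mem_iff.1 hxe with rfl | rfl
      · exact Or.inl hx
      · exact Or.inr hx
    by_cases hbu : a ∈ zone E s T u ∧ b ∈ zone E s T u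
    · rcases horv with ha | hb
      · exact COMMON a hbu.1 ha
      · exact COMMON b hbu.2 hb
    · by_cases hbv : a ∈ zone E s T v ∧ b ∈ zone E s T v
      · rcases horu with ha | hb
        · exact COMMON a ha hbv.1
        · exact COMMON b hb hbv.2
      · exact (A4 u hu hbu horu).symm.trans (A4 v hv hbv horv)

end Cone

section TheoremIHanging

variable {V : Type*} [Fintype V]

/-- **THEOREM I for cones with hanging subgraphs (prim-hp-2 gen 36).**  `E` an edge set on a finite vertex type, `s` a source, `R ∌ s` a set of
NEIGHBOURS of `s`, and suppose every vertex `x ≠ s` not adjacent to `s` but `(G − s)`-reachable from `R` hangs from a spoked vertex: there is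
`y` with `sy ∈ E` lying on every `(G − s)`-walk from any neighbour of `s` to `x`.  Then for all increasing `F, G` of the edge cluster,
`0 ≤ Σ_{ω : no r ∈ R is joined to s both in ω ∩ E and in ωᶜ ∩ E} (F(C_s(ω∩E)) − F(C_s(ωᶜ∩E))) · (G(C_s(ω∩E)) − G(C_s(ωᶜ∩E)))`.
(Cones and R-local cones: no such `x`.  New: wheels, fans, cliques through `s` with arbitrary subgraphs hanging from single vertices.) [this work] -/
theorem cone_hanging_bic_nonneg (E : Set (Sym2 V)) (s : V) (R : Set V) (hRs : s ∉ R) (hRN : ∀ u ∈ R, s(s, u) ∈ E)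
    (hhang : ∀ x, x ≠ s → s(s, x) ∉ E → (∃ u ∈ R, (openGraph {e | e ∈ E ∧ s ∉ e}).Reachable u x) →
      ∃ y, s(s, y) ∈ E ∧ ∀ w, s(s, w) ∈ E → ∀ p : (openGraph {e | e ∈ E ∧ s ∉ e}).Walk w x, y ∈ p.support)
    {F G : Set (Sym2 V) → ℝ} (hF : Monotone F) (hG : Monotone G) :
    0 ≤ ∑ ω ∈ Finset.univ.filter (fun ω : Set (Sym2 V) =>
        ∀ r ∈ R, ¬ ((openGraph (ω ∩ E)).Reachable s r ∧ (openGraph (ωᶜ ∩ E)).Reachable s r)),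
      (F (openEdgeCluster (ω ∩ E) s) - F (openEdgeCluster (ωᶜ ∩ E) s)) *
        (G (openEdgeCluster (ω ∩ E) s) - G (openEdgeCluster (ωᶜ ∩ E) s)) := by
  have hcons : ∀ T : Set (Sym2 V), (∀ r ∈ R, ¬ ((openGraph (T ∩ E)).Reachable s r ∧ (openGraph (Tᶜ ∩ E)).Reachable s r)) →
      ∀ u ∈ R, ∀ v ∈ R, ∀ e, e ∈ Cone.zblock E s T u → e ∈ Cone.zblock E s T v → (s(s, u) ∈ T ↔ s(s, v) ∈ T) :=
    fun T hT u hu v hv e heu hev => Cone.spoke_iff_of_mem_zblock_hanging hRN hRs hT hhang hu hv heu hev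
  refine sum_nonneg_of_parts _ _ (Cone.zpart E s R) ?_ ?_ ?_ ?_
  · intro T hT
    rw [Finset.mem_filter] at hT
    exact Cone.mem_zpart_self (hcons T hT.2)
  · intro T hT M hM
    rw [Finset.mem_filter] at hT ⊢
    exact ⟨Finset.mem_univ _, Cone.mem_constraint_of_mem_zpart hRN hRs hT.2 (hcons T hT.2) hM⟩
  · intro T hT M hM
    rw [Finset.mem_filter] at hT
    exact Cone.zpart_eq_of_mem hRN (hcons T hT.2) hM
  · intro T hT
    rw [Finset.mem_filter] at hT
    exact Cone.zpart_sum_nonneg hRN hRs hT.2 (hcons T hT.2) hF hG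

end TheoremIHanging

end Antithetic

end Summit.CriticalPhenomena.PercolationContinuityZ3.Theorems
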